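import Mathlib.MeasureTheory.Measure.Haar.InnerProductSpace
import Literature.Analysis.Fourier.LpMultiplier
import HarnessLib

/-!
# `Lᵖ` Fourier multipliers: transport along linear isometries

If `U : V ≃ₗᵢ W` is a linear isometry between finite-dimensional real inner product spaces and
`M ∈ M_p(W)`, then `M ∘ U ∈ M_p(V)` with the SAME constant: `𝓕(f ∘ U) = 𝓕f ∘ U`, so
`(M ∘ U)(D) f = (M(D)(f ∘ U⁻¹)) ∘ U`, and `U` preserves Lebesgue measure. In particular `M_p` is
invariant under orthogonal changes of variables — "Since an orthogonal change of variables does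
not change the multiplier norm (Theorem 2.8)" [BrennerThomeeWahlbin1975, Ch. 1, proof of
Cor 5.2] — and a multiplier statement on an abstract `V` may be read in orthonormal coordinates
on `EuclideanSpace ℝ (Fin n)` (used to diagonalise quadratic phases,
`GaussianMultiplierTest.lean`).

## References

* [BrennerThomeeWahlbin1975] P. Brenner, V. Thomée, L. B. Wahlbin, LNM 434 (1975), Ch. 1
  Thm 2.8 and proof of Cor 5.2 p. 26.
-/

noncomputable section

open MeasureTheory FourierTransform
open scoped SchwartzMap ENNReal NNReal

namespace Literature.Analysis.Fourier

variable {V : Type*} [NormedAddCommGroup V] [InnerProductSpace ℝ V] [FiniteDimensional ℝ V]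
  [MeasurableSpace V] [BorelSpace V]
  {W : Type*} [NormedAddCommGroup W] [InnerProductSpace ℝ W] [FiniteDimensional ℝ W]
  [MeasurableSpace W] [BorelSpace W] {ι κ : Type*} [Fintype ι] [Fintype κ]

/-- **`(M ∘ U)(D) f = (M(D)(f ∘ U⁻¹)) ∘ U`** for a linear isometry `U : V ≃ₗᵢ W`.
[cite: BrennerThomeeWahlbin1975, Ch. 1 Thm 2.8] -/
theorem multiplierOp_comp_linearIsometryEquiv (U : V ≃ₗᵢ[ℝ] W) (M : W → Matrix κ ι ℂ)
    (f : V → ι → ℂ) :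
    multiplierOp (fun ξ => M (U ξ)) f = fun x => multiplierOp M (f ∘ U.symm) (U x) := by
  have hf : f = (f ∘ U.symm) ∘ U := by funext x; simp
  have h𝓕 : ∀ ξ, 𝓕 f ξ = 𝓕 (f ∘ U.symm) (U ξ) := fun ξ => by
    conv_lhs => rw [hf]
    exact Real.fourier_comp_linearIsometry U (f ∘ U.symm) ξ
  funext x
  rw [multiplierOp_apply, multiplierOp_apply]
  have hint : (fun ξ => (M (U ξ)).mulVec (𝓕 f ξ))
      = (fun η => (M η).mulVec (𝓕 (f ∘ U.symm) η)) ∘ U := by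
    funext ξ; simp [h𝓕 ξ]
  rw [hint, Real.fourierInv_comp_linearIsometry]

/-- **Transport of `M_p` along a linear isometry, same constant**: `M ∈ M_p(W) ⟹ M ∘ U ∈ M_p(V)`.
[cite: BrennerThomeeWahlbin1975, Ch. 1 Thm 2.8] -/
theorem IsLpMultiplierWith.comp_linearIsometryEquiv (U : V ≃ₗᵢ[ℝ] W) {p : ℝ≥0∞} {C : ℝ≥0}
    {M : W → Matrix κ ι ℂ} (h : IsLpMultiplierWith p C M) :
    IsLpMultiplierWith p C (fun ξ => M (U ξ)) := by
  have hU : MeasurePreserving U := U.measurePreserving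
  have hUs : MeasurePreserving U.symm := U.symm.measurePreserving
  -- the transported test function `f ∘ U⁻¹` on `W`
  have hg : ∀ f : 𝓢(V, ι → ℂ),
      (⇑(SchwartzMap.compCLMOfContinuousLinearEquiv ℂ
        (U.symm.toContinuousLinearEquiv : W ≃L[ℝ] V) f) : W → ι → ℂ) = ⇑f ∘ U.symm := by
    intro f; rfl
  refine ⟨fun f => ?_, fun f => ?_⟩
  · -- guard: the integrand on `V` is the integrand on `W` composed with `U`
    set g := SchwartzMap.compCLMOfContinuousLinearEquiv ℂ
      (U.symm.toContinuousLinearEquiv : W ≃L[ℝ] V) f with hgdef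
    have hf : (⇑f : V → ι → ℂ) = (⇑f ∘ U.symm) ∘ U := by funext x; simp
    have hint : (fun ξ => (M (U ξ)).mulVec (𝓕 (⇑f) ξ))
        = (fun η => (M η).mulVec (𝓕 (⇑g) η)) ∘ U := by
      funext ξ
      simp only [Function.comp_apply]
      conv_lhs => rw [hf]
      rw [Real.fourier_comp_linearIsometry U (⇑f ∘ U.symm) ξ, hg]
    rw [hint]
    exact (hU.integrable_comp_emb U.toHomeomorph.measurableEmbedding).2 (h.integrable g)
  · set g := SchwartzMap.compCLMOfContinuousLinearEquiv ℂ
      (U.symm.toContinuousLinearEquiv : W ≃L[ℝ] V) f with hgdef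
    have hop : multiplierOp (fun ξ => M (U ξ)) ⇑f = (multiplierOp M ⇑g) ∘ U := by
      rw [multiplierOp_comp_linearIsometryEquiv U M ⇑f, hg]
      rfl
    have hmeas : AEStronglyMeasurable (multiplierOp M ⇑g) volume := by
      rw [multiplierOp_apply, Real.fourierInv_eq_fourier_comp_neg]
      exact (VectorFourier.fourierIntegral_continuous Real.continuous_fourierChar
        continuous_inner (h.integrable g).comp_neg).aestronglyMeasurable
    rw [hop, eLpNorm_comp_measurePreserving hmeas hU]
    refine (h.bound g).trans (le_of_eq ?_)
    rw [hg, eLpNorm_comp_measurePreserving f.continuous.aestronglyMeasurable hUs]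

/-- `M ∈ M_p(W) ⟹ M ∘ U ∈ M_p(V)`. [cite: BrennerThomeeWahlbin1975, Ch. 1 Thm 2.8] -/
theorem IsLpMultiplier.comp_linearIsometryEquiv (U : V ≃ₗᵢ[ℝ] W) {p : ℝ≥0∞}
    {M : W → Matrix κ ι ℂ} (h : IsLpMultiplier p M) : IsLpMultiplier p (fun ξ => M (U ξ)) := by
  obtain ⟨C, hC⟩ := h
  exact (hC.comp_linearIsometryEquiv U).isLpMultiplier

end Literature.Analysis.Fourier

end
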